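import Literature.AlgebraicGeometry.Motives.AbelianVarietyPurelyTranscendentalPointsAnyIndex
import Literature.AlgebraicGeometry.Motives.AbelianVarietyBaseChange
import Literature.AlgebraicGeometry.Motives.FrobeniusEtale
import Literature.AnabelianGeometry.AbsoluteAnabelian.AbsTopIII.KummerFaithfulProfiniteProofs
import HarnessLib

/-!
# [AbsTopIII] Rmk. 1.5.4 (iii), abelian-variety clause: condition (a) of Def. 1.5 is insensitive to
# purely transcendental extension of the ground field

Proof-only companion of `AbsTopIII/KummerFaithful.lean` (S. Mochizuki, *Topics in Absolute Anabelian
Geometry III*, §1, Rmk. 1.5.4 (iii) p. 34, lit key `paper:url-5493eb38cbb7`: "`k := ℚ_p(x_i)_{i ∈ I}`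
[...] constitutes an example of a Kummer-faithful field which is not sub-`p`-adic."  Printed argument,
p. 34, l. 9–19: a point `f` in the kernel of the Kummer map of `A / k_H` lies, after descending `A` to
`A′` over `k′_H` with `k_H = k′_H(x_i)_{i ∈ I″}`, in `A′(k′_H)`, and "since `k′_H` is algebraically
closed in `k_H`, it thus follows that all roots of `f` defined over `k_H` are in fact defined over
`k′_H`" — contradicting the Kummer-faithfulness of the sub-`p`-adic field `k′_H`.)

The named fact `Rmk_1_5_4_iii` is reduced in the tree to the ABELIAN-VARIETY clause of Def. 1.5 for
the finite extensions `k'` of `ℚ_p(x_i)_{i ∈ I}` (`Rmk_1_5_4_iii_of_abelianVariety_clause`,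
`KummerFaithfulPurelyTranscendentalProofs`).  The tree's route for abelian varieties (the printed
argument with "all roots are defined over `k′_H`" strengthened to "no new points in a purely
transcendental extension") has two ingredients beyond the torus case: (K0) an abelian variety over `k' = E(x_T)` (`E` finitely
generated over `ℚ_p`, `T` infinite) is the base change of an abelian variety `A₀` over a finitely
generated `E(x_{T₀}) =: k₀`, over which `k'` is purely transcendental — NOT proved here; and
(K-∞) **an abelian variety acquires no new rational points in a purely transcendental extension**,
`A₀(k₀(x_S)) = A₀(k₀)` (the tree's `AbelianVariety.algPoints_const_of_isFractionRing_mvPolynomial_index`,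
Milne, *Abelian Varieties*, §3 Cor. 3.8).  This file proves the consequence of (K-∞) that the final
assembly consumes:

* `AbelianVariety.specOverMap_comp_injective`, `…_bijective_of_isFractionRing_mvPolynomial`
  — the map `A₀(k₀) → A₀(K)` along a field extension is injective, and BIJECTIVE when
  `K = k₀(x_S)` is purely transcendental (`k₀` infinite);
* **`divisibleElementsTrivial_points_baseChange_of_isFractionRing_mvPolynomial`** — if
  `⋂_N N·A₀(k₀) = 0` then `⋂_N N·(A₀ ⊗ K)(K) = 0` for `K = k₀(x_S)`;
* **`divisibleElementsTrivial_points_of_iso_baseChange`** — hence `⋂_N N·A(K) = 0` for every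
  abelian variety `A / K` which is `K`-isomorphic, as a group scheme, to such a base change
  (the output shape of (K0)).

So the abelian-variety clause of Rmk. 1.5.4 (iii) — hence `Rmk_1_5_4_iii` — follows from (K0) and
Def. 1.5 (a) for abelian varieties over FINITELY GENERATED extensions of `ℚ_p` (= the open part of
FACT-LIST row F-0369, `Rmk_1_5_4_i`).  HONEST FRAMING: classical; typed ≠ discharged for (K0);
nothing here bears on [IUTchIII] Cor. 3.12.
-/

noncomputable section

open CategoryTheory AlgebraicGeometry

namespace Literature.AnabelianGeometry.AbsoluteAnabelian.AbsTopIII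

open Literature.AlgebraicGeometry.Motives

universe u

/-! ### Condition (a) of Def. 1.5 under injective homomorphisms -/

/-- Condition (a) of Def. 1.5 passes to subgroups: if `G` embeds in `H` and `H` has no non-trivial
infinitely divisible element, neither has `G` (local copy of the helper of
`KummerFaithfulBaseChangeProofs`, to keep imports light). [cite: MochizukiAbsTopIII2015, Def 1.5 (a) p.32] -/
private theorem DivisibleElementsTrivial.of_injective_monoidHom' {G H : Type*} [CommGroup G]
    [CommGroup H] (f : G →* H) (hf : Function.Injective f) (h : DivisibleElementsTrivial H) :
    DivisibleElementsTrivial G := by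
  refine ⟨fun x hx => hf ?_⟩
  rw [map_one]
  refine h.eq_one_of_forall_exists_pow (f x) fun n hn => ?_
  obtain ⟨y, hy⟩ := hx n hn
  exact ⟨f y, by rw [← map_pow, hy]⟩

/-! ### Points of an abelian variety along a field extension -/

section Points

variable {k₀ : Type u} [Field k₀] (A₀ : AbelianVariety k₀) (K : Type u) [Field K] [Algebra k₀ K]

/-- `A₀(k₀) → A₀(K)`, `P ↦ Spec (k₀ → K) ≫ P`, is injective (a `k₀`-point is determined by its
image over any extension: precomposition with `Spec` of a field map is injective on field-valued
points, the tree's `specMap_comp_injective`). [cite: Milne1986AbelianVarieties, §3 Cor. 3.8] -/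
theorem _root_.Literature.AlgebraicGeometry.Motives.AbelianVariety.specOverMap_comp_injective :
    Function.Injective fun P : A₀.Points k₀ =>
      AlgPoints.specOverMapOfAlgHom (Algebra.ofId k₀ K) ≫ P := by
  intro P Q h
  have h' : (AlgPoints.specOverMapOfAlgHom (Algebra.ofId k₀ K) ≫ P).left =
      (AlgPoints.specOverMapOfAlgHom (Algebra.ofId k₀ K) ≫ Q).left := congrArg (fun R => R.left) h
  rw [Over.comp_left, Over.comp_left, AlgPoints.specOverMapOfAlgHom_left] at h'
  exact Over.OverMorphism.ext (specMap_comp_injective (Algebra.ofId k₀ K).toRingHom A₀.X.left h')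

/-- **`A₀(k₀) → A₀(k₀(x_S))` is bijective** (`k₀` infinite): an abelian variety acquires no new
rational points in a purely transcendental extension (the tree's
`AbelianVariety.algPoints_const_of_isFractionRing_mvPolynomial_index`, Milne Cor. 3.8).
[cite: Milne1986AbelianVarieties, §3 Cor. 3.8] -/
theorem _root_.Literature.AlgebraicGeometry.Motives.AbelianVariety.specOverMap_comp_bijective_of_isFractionRing_mvPolynomial
    [Infinite k₀] (S : Type u) [Algebra (MvPolynomial S k₀) K]
    [IsScalarTower k₀ (MvPolynomial S k₀) K] [IsFractionRing (MvPolynomial S k₀) K] :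
    Function.Bijective fun P : A₀.Points k₀ =>
      AlgPoints.specOverMapOfAlgHom (Algebra.ofId k₀ K) ≫ P := by
  refine ⟨A₀.specOverMap_comp_injective K, fun x => ?_⟩
  obtain ⟨P₀, hP₀⟩ := A₀.algPoints_const_of_isFractionRing_mvPolynomial_index S K x
  exact ⟨P₀, hP₀.symm⟩

end Points

/-! ### Def. 1.5 (a) over a purely transcendental extension -/

/-- **Condition (a) of Def. 1.5 for `A₀ ⊗ K` over `K = k₀(x_S)` follows from condition (a) for
`A₀` over `k₀`** (`k₀` infinite, `S` any set of variables): `(A₀ ⊗ K)(K) ≅ A₀(K)` (the tree's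
`AbelianVariety.pointsMulEquiv`) `≅ A₀(k₀)` (`specOverMap_comp_bijective_…`, a group isomorphism by
Mathlib `MonObj.comp_mul`), and `⋂_N N·A₀(k₀) = 0`. [cite: MochizukiAbsTopIII2015, Rmk 1.5.4 (iii) p.34] -/
theorem divisibleElementsTrivial_points_baseChange_of_isFractionRing_mvPolynomial
    {k₀ : Type u} [Field k₀] [Infinite k₀] (A₀ : AbelianVariety k₀) (K : Type u) [Field K]
    [Algebra k₀ K] (S : Type u) [Algebra (MvPolynomial S k₀) K]
    [IsScalarTower k₀ (MvPolynomial S k₀) K] [IsFractionRing (MvPolynomial S k₀) K]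
    (hA₀ : DivisibleElementsTrivial (A₀.Points k₀)) :
    DivisibleElementsTrivial ((A₀.baseChange K).Points K) := by
  -- `A₀(k₀) → A₀(K)` as a group homomorphism (precomposition), bijective
  let φ : A₀.Points k₀ →* A₀.Points K :=
    MonoidHom.mk' (fun P => AlgPoints.specOverMapOfAlgHom (Algebra.ofId k₀ K) ≫ P)
      fun P Q => MonObj.comp_mul _ P Q
  have hφ : Function.Bijective φ :=
    A₀.specOverMap_comp_bijective_of_isFractionRing_mvPolynomial K S
  exact DivisibleElementsTrivial.of_mulEquiv
    ((MulEquiv.ofBijective φ hφ).trans (A₀.pointsMulEquiv K)).symm hA₀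

/-- **Condition (a) of Def. 1.5 for every abelian variety `A / K`, `K = k₀(x_S)`, which is the base
change of an abelian variety `A₀ / k₀` with `⋂_N N·A₀(k₀) = 0`** (as group schemes over `K`: an
isomorphism `A.X ≅ (A₀ ⊗ K).X` respecting the group laws; points are transported along it by
Mathlib `MonObj.mul_comp`) — the form in which the descent step (K0) of Rmk. 1.5.4 (iii) delivers
`A`. [cite: MochizukiAbsTopIII2015, Rmk 1.5.4 (iii) p.34] -/
theorem divisibleElementsTrivial_points_of_iso_baseChange
    {k₀ : Type u} [Field k₀] [Infinite k₀] (K : Type u) [Field K] [Algebra k₀ K] (S : Type u)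
    [Algebra (MvPolynomial S k₀) K] [IsScalarTower k₀ (MvPolynomial S k₀) K]
    [IsFractionRing (MvPolynomial S k₀) K]
    (A : AbelianVariety K) (A₀ : AbelianVariety k₀) (e : A.X ≅ (A₀.baseChange K).X) [IsMonHom e.hom]
    (hA₀ : DivisibleElementsTrivial (A₀.Points k₀)) :
    DivisibleElementsTrivial (A.Points K) := by
  -- postcomposition with `e.hom` : `A(K) →* (A₀ ⊗ K)(K)`, injective
  let ψ : A.Points K →* (A₀.baseChange K).Points K :=
    MonoidHom.mk' (fun P => P ≫ e.hom) fun P Q => MonObj.mul_comp P Q e.hom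
  have hψ : Function.Injective ψ := fun P Q h => by
    have h' : (P ≫ e.hom) ≫ e.inv = (Q ≫ e.hom) ≫ e.inv := congrArg (fun R => R ≫ e.inv) h
    simpa only [Category.assoc, Iso.hom_inv_id, Category.comp_id] using h'
  exact DivisibleElementsTrivial.of_injective_monoidHom' ψ hψ
    (divisibleElementsTrivial_points_baseChange_of_isFractionRing_mvPolynomial A₀ K S hA₀)

/-- The same with the hypothesis on `A₀` supplied by condition (a) for ALL abelian varieties over the
small field `k₀` (e.g. `k₀` finitely generated over `ℚ_p`, FACT-LIST row F-0369 / Rmk. 1.5.4 (i)–(ii)):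
**Def. 1.5 (a) for abelian varieties passes from `k₀` to every abelian variety over `k₀(x_S)` defined
over `k₀`.** [cite: MochizukiAbsTopIII2015, Rmk 1.5.4 (iii) p.34] -/
theorem divisibleElementsTrivial_points_of_iso_baseChange_of_forall
    {k₀ : Type u} [Field k₀] [Infinite k₀]
    (hk₀ : ∀ B : AbelianVariety k₀, DivisibleElementsTrivial (B.Points k₀))
    (K : Type u) [Field K] [Algebra k₀ K] (S : Type u)
    [Algebra (MvPolynomial S k₀) K] [IsScalarTower k₀ (MvPolynomial S k₀) K]
    [IsFractionRing (MvPolynomial S k₀) K]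
    (A : AbelianVariety K) (A₀ : AbelianVariety k₀) (e : A.X ≅ (A₀.baseChange K).X) [IsMonHom e.hom] :
    DivisibleElementsTrivial (A.Points K) :=
  divisibleElementsTrivial_points_of_iso_baseChange K S A A₀ e (hk₀ A₀)

end Literature.AnabelianGeometry.AbsoluteAnabelian.AbsTopIII
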